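import Literature.NumberTheory.EllipticCurves.HeegnerPointsKolyvaginPrimaryPairingProofs
import Literature.NumberTheory.EllipticCurves.HeegnerPointsKolyvaginCebotarevProofs
import Literature.NumberTheory.EllipticCurves.BSDRankZeroDensity
import HarnessLib

/-!
# McCallum's Corollary 3.2 at level `p^M` from the Čebotarev density theorem

Sibling proof file of `HeegnerPointsKolyvaginCebotarevProofs` (McCallum 1991, Cor. 3.2 for
`M = 1`: `McCallum1991_cor_3_2_eigen_of_chebotarev`) and
`HeegnerPointsKolyvaginPrimaryPairingProofs` (the level-`p^M` algebra of McCallum's §3), written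
for the named fact `Literature.NumberTheory.EllipticCurves.Kolyvagin1990_sha_primary_finite N W K`
(Gross 1991, Thm. 1.3 (2), `p`-primary part; McCallum 1991, §1), which
`Kolyvagin1990_sha_primary_finite_of_hypothesesM` (`HeegnerPointsKolyvaginPrimaryDescentProofs`)
reduces to Kolyvagin's descent data `KolyvaginDescent.HypothesesM` on `H¹(K, E[p^M])` for all
`M`. This file **proves**, sorry-free, the `cebotarev` input of that data at every level `M` —
McCallum's Cor. 3.2 as printed, for `H¹(K, E_{p^M})` — from the two standard named facts it rests
on, the Čebotarev density theorem (`Literature.NumberTheory.Automorphic.chebotarev_artinRep`,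
Tate 1967, §2.4) and the Weil pairing on `E[p]` (`WeierstrassCurve.exists_weilPairing`, Silverman
*AEC* III.8.1):

* `exists_kolyvaginPrime_gt_pow`: for `K` imaginary quadratic, `p` odd with `ρ̄_{E,p}` onto,
  `τ`-eigenclasses `c_i ∈ H¹(K, E[p^M])` killed by `p^{eᵢ}` and independent
  (`∑ aᵢcᵢ = 0 ⟹ p^{eᵢ} ∣ aᵢ`), and `N_i ≤ min(e_i, M)`: above every bound a prime `ℓ ∤ N d_K p`,
  inert in `K`, with `Frob(ℓ) = Frob(∞)` in `Gal(K(E_{p^M})/ℚ)` (`FrobEqFrobInfty W K (p^M) ℓ`,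
  Cor. 3.2 (1)) and `ord c_{i,λ} = p^{N_i}` exactly at `λ ∋ ℓ` (Cor. 3.2 (2):
  `p^{N_i} c_{i,λ} = 0`, `p^{N_i-1} c_{i,λ} ≠ 0`);
* `McCallum1991_cor_3_2_pow_of_chebotarev`: the same with McCallum's printed hypotheses —
  non-zero classes, *"any relation `a₁c₁ + ⋯ + a_rc_r = 0` implies that `ord c_i` divides
  `a_i`"* (`a_i c_i = 0`), `N_i ≤ M_i`, `p^{M_i} = ord c_i` (as `p^{N_i-1} c_i ≠ 0`) — i.e. in
  the shape of the field `KolyvaginDescent.HypothesesM.cebotarev`, the orders `p^{M_i}` being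
  produced by `exists_addOrderOf_eq_pow` (`H¹(K, E[p^M])` is killed by `p^M`,
  `zsmul_galH1Torsion_eq_zero`).

## The proof

It is the tree's `exists_kolyvaginPrime_gt` (McCallum's proof of Prop. 3.1 and Cor. 3.2, PDF
p. 280, formalised there for `M = 1`; see that file's module docstring for the line-by-line
correspondence) with `E[p]` replaced by `E[p^M]` wherever the level of the classes enters —
`Γ_{K(E[p^M])}`, the subgroup `𝒩` where the `[c_i, ·]` vanish, the unramifiedness of the `c_i`,
the local criterion (3) at `λ` (`mem_torsionLocalKer_iff_h1Eval_eq_zero`, stated for general `n`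
in the tree; its hypothesis `λ ∤ p^M` from `λ ∤ p`), condition (1) on `E(ℚ̄)[p^M]` — and with the
three algebraic inputs taken from `HeegnerPointsKolyvaginPrimaryPairingProofs`: the element of
`Γ_K` acting as `-1` on `E[p^M]` (`smul_eq_neg_geomTorsion_pow`, from `-1 ∈ ρ̄_{E,p}(Γ_K)`), the
eigenvectors `e_± ∈ E[p^M]` of order `p^M` of the involutive lift of complex conjugation
(`IsLiftOfAut.exists_eigenvector_pow`), and the element `ρ ∈ Γ_{K(E[p^M])}` with
`ord [c_i, ρ^τρ] = p^{N_i}` (`IsLiftOfAut.exists_h1Eval_conj_mul_order`, McCallum's (2) at level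
`p^M`). The image of `Γ_K` is used on `E_p` only (`KolyvaginImage.*` from
`Gal(ℚ(E_p)/ℚ) = GL₂(ℤ/p)`, McCallum's standing hypothesis of §3); nothing is assumed about
`ρ_{E,p^M}`. The local orders are read off through `[p^a c_i, F] = p^a [c_i, F]` for the classes
`p^a c_i`, unramified where `c_i` is.

## What this leaves of `Kolyvagin1990_sha_primary_finite`

For the primes `p` of Gross's §2 (odd, `ρ̄_{E,p}` onto, `E` without CM, `d_K ∉ {-3, -4}`) the
data `HypothesesM` now lacks exactly two inputs at level `p^M`, both absent from the tree for
`M > 1`: Kolyvagin's classes `c_M(n)` with McCallum's Lemma 4.3 / Prop. 4.4 / Gross's Prop. 5.4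
(2) (CM points of conductor `n` on `X₀(N)`, the Euler-system relations), and the local duality
statement McCallum Lemma 5.3 with Prop. 2.2 (Tate local duality at `λ`); the remaining primes
(`p ∣ t_{E/K}`, `p = 2`, CM) are Kolyvagin 1990 [K1] itself. No named fact is introduced here.

## References

* W. G. McCallum, *Kolyvagin's work on Shafarevich–Tate groups*, in *`L`-functions and arithmetic
  (Durham, 1989)*, LMS Lecture Note Ser. 153, CUP (1991), 295–316: §3, Prop. 3.1, Cor. 3.2 and
  their proofs (held `book:editornd-l-functions-arithmetic`, PDF pp. 279–280). [McCallumLMS1991]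
* B. H. Gross, *Kolyvagin's work on modular elliptic curves*, same volume, 235–256: §3
  (3.1)–(3.2), §9 (PDF pp. 216, 227–229). [GrossLMS1991]
* J. Tate, *Global class field theory*, in Cassels–Fröhlich (1967), §2.4 (Čebotarev).
  [TateGCFT1967]
* J. H. Silverman, *The Arithmetic of Elliptic Curves*, 2nd ed. (2009), III.8.1, VII.4.1.
  [SilvermanAEC2009]
-/

noncomputable section

open scoped Classical Pointwise
open WeierstrassCurve NumberField IsDedekindDomain Field
open Literature.NumberTheory.GaloisRepresentations

universe u

namespace Literature.NumberTheory.EllipticCurves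

section Main

variable {W : WeierstrassCurve ℚ} {K : Type u} [Field K] [NumberField K]

/-- **One Kolyvagin prime of level `p^M` above any bound, with prescribed local orders**
(McCallum 1991, Prop. 3.1 and Cor. 3.2 with their proofs, PDF pp. 279–280; Gross 1991, §9 for
`M = 1`). Hypotheses: `K` imaginary quadratic with complex conjugation `c`; `p` odd with
`ρ̄_{E,p}` onto and a Weil pairing on `E[p]`; `σ`-eigenclasses `c_i ∈ H¹(K, E[p^M])`
(`c_* c_i = ± c_i`) killed by `p^{eᵢ}` and *independent* (McCallum: *"any relation
`a₁c₁ + ⋯ + a_rc_r = 0` implies that `ord c_i` divides `a_i`"*, here `∑ aᵢ cᵢ = 0 ⟹ p^{eᵢ} ∣ aᵢ`);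
exponents `N_i ≤ min(e_i, M)`; the Čebotarev density theorem (`Automorphic.chebotarev_artinRep`).
Conclusion: for every `b` there is a prime `ℓ > b` with `ℓ ∤ N·d_K`, `ℓ ≠ p`, `(ℓ)` prime in
`𝓞 K`, `Frob(ℓ) = Frob(∞)` in `Gal(K(E_{p^M})/ℚ)` (`FrobEqFrobInfty W K (p^M) ℓ`, Cor. 3.2 (1)),
and, at the place `λ ∋ ℓ`, `ord c_{i,λ} = p^{N_i}` exactly (Cor. 3.2 (2)):
`p^{N_i} c_{i,λ} = 0` and `p^{N_i - 1} c_{i,λ} ≠ 0` for `N_i ≥ 1`. The proof is the tree's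
`exists_kolyvaginPrime_gt` (the case `M = 1`, `N_i ≤ 1`) line by line — complex conjugation and
its involutive lift, the image of `Γ_K` on `E_p` (`KolyvaginImage.*`), the eigenvectors on `E_p`,
a Frobenius in `c₀ · res(ρ𝒩)` by density, inertness from `FrobeniusPlaces`, the local criterion
(3) at `λ` — with the three level-`p` algebraic inputs replaced by their level-`p^M` versions of
`HeegnerPointsKolyvaginPrimaryPairingProofs`: `-1` on `E_{p^M}` (`smul_eq_neg_geomTorsion_pow`),
eigenvectors of order `p^M` (`IsLiftOfAut.exists_eigenvector_pow`) and the element `ρ` with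
`ord [c_i, ρ^τρ] = p^{N_i}` (`IsLiftOfAut.exists_h1Eval_conj_mul_order`, McCallum's (2)).
[cite: McCallumLMS1991, §3 Cor. 3.2 (proof, with Prop. 3.1)] -/
theorem exists_kolyvaginPrime_gt_pow (hC : Automorphic.chebotarev_artinRep) {N : ℕ} [NeZero N]
    [W.IsElliptic] (hK : IsImaginaryQuadratic K) {p : ℕ} (hp : p.Prime) (hp2 : p ≠ 2)
    (hρ : W.HasSurjectiveModNGaloisRep p) (hW : W.exists_weilPairing p) {M : ℕ} (hM : 1 ≤ M)
    {c : K ≃ₐ[ℚ] K} (hc : c ≠ 1) {r : ℕ}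
    (cs : Fin r → galH1Torsion (W.baseChange K) ((p ^ M : ℕ) : ℤ))
    (hτ : ∀ i, ∃ e : ℤ, (e = 1 ∨ e = -1) ∧ conjAct W c ((p ^ M : ℕ) : ℤ) (cs i) = e • cs i)
    (ex : Fin r → ℕ) (hex : ∀ i, ((p : ℤ) ^ ex i) • cs i = 0)
    (hind : ∀ a : Fin r → ℤ, ∑ i, a i • cs i = 0 → ∀ i, ((p : ℤ) ^ ex i) ∣ a i)
    (Nv : Fin r → ℕ) (hNe : ∀ i, Nv i ≤ ex i) (hNM : ∀ i, Nv i ≤ M) (b : ℕ) :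
    ∃ ℓ : ℕ, b < ℓ ∧ ℓ.Prime ∧ ¬ ℓ ∣ N ∧ ¬ ((ℓ : ℤ) ∣ NumberField.discr K) ∧ ℓ ≠ p ∧
      (Ideal.span {(ℓ : 𝓞 K)}).IsPrime ∧ FrobEqFrobInfty W K (p ^ M) ℓ ∧
      ∀ i, ∀ v : HeightOneSpectrum (𝓞 K), (ℓ : 𝓞 K) ∈ v.asIdeal →
        (((p : ℤ) ^ Nv i) • cs i ∈
            (W.baseChange K).torsionLocalKer (v.adicCompletion K) ((p ^ M : ℕ) : ℤ) ∧
          (Nv i ≠ 0 → ((p : ℤ) ^ (Nv i - 1)) • cs i ∉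
            (W.baseChange K).torsionLocalKer (v.adicCompletion K) ((p ^ M : ℕ) : ℤ))) := by
  classical
  haveI : Fact p.Prime := ⟨hp⟩
  haveI : Algebra.IsQuadraticExtension ℚ K := ⟨hK.1⟩
  haveI : IsTotallyComplex K := hK.2
  have hp0 : (p : ℤ) ≠ 0 := by exact_mod_cast hp.ne_zero
  have hn0 : ((p ^ M : ℕ) : ℤ) ≠ 0 := by exact_mod_cast pow_ne_zero M hp.ne_zero
  have hpn : (p : ℤ) ∣ ((p ^ M : ℕ) : ℤ) := by
    rw [Nat.cast_pow]; exact dvd_pow_self _ (by omega)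
  have hodd : Odd p := hp.odd_of_ne_two hp2
  -- ### Step A: complex conjugation, the involutive lift, the image of `Γ_K` on `E_p`
  obtain ⟨c₀, hc₀⟩ := exists_isComplexConjugation (Rat.castHom ℝ)
  set t : AlgebraicClosure K ≃+* AlgebraicClosure K :=
    (absGaloisTransport (K := ℚ) (L := K) c₀).toRingEquiv with ht_def
  have ht : IsLiftOfAut c t :=
    RatClosure.isLiftOfAut_absGaloisTransport_of_isImaginaryQuadratic hK hc hc₀
  have hinv : ∀ x, t (t x) = x := fun x ↦
    RatClosure.absGaloisTransport_absGaloisTransport_of_sq_eq_one hc₀.sq_eq_one x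
  have hT : ∀ P : geomTorsion (W.baseChange K) p, p • P = 0 := fun P ↦ by
    have := (mem_geomTorsion_iff (W.baseChange K) p _).mp P.2
    apply Subtype.ext
    rw [AddSubgroupClass.coe_nsmul, ← natCast_zsmul]
    exact this
  have hcard : Nat.card (geomTorsion (W.baseChange K) p) = p ^ 2 :=
    card_torsionPoints_eq_sq_holds (W.baseChange K) (AlgebraicClosure K)
      (by exact_mod_cast hp.ne_zero)
  obtain ⟨eT⟩ := KolyvaginImage.nonempty_addEquiv_of_card_eq_sq hT hcard
  have hsq := RatClosure.exists_smul_eq_of_sq (K := K) W hK.1 (n := p) hρ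
  obtain ⟨z, hz⟩ := KolyvaginImage.exists_smul_eq_neg eT hsq
  have hS := KolyvaginImage.eq_bot_or_eq_top eT hsq hp2
  have hCe := KolyvaginImage.exists_eq_zsmul eT hsq hp2
  -- eigenvectors of `τ` on `E(K̄)[p]`, transported from `E(ℚ̄)[p]`
  obtain ⟨⟨vPlus, hvPlus0, hvPlus⟩, ⟨vMinus, hvMinus0, hvMinus⟩⟩ :=
    RatClosure.exists_eigenvectors W hc₀ hW hp2
  set θ := RatClosure.torsionEquiv (K := K) W p with hθ
  have hePlus : ht.torsionMap W p (θ vPlus) = θ vPlus := by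
    rw [← RatClosure.torsionEquiv_smul_of_lift W ht c₀ (fun _ ↦ rfl) p vPlus, hvPlus]
  have heMinus : ht.torsionMap W p (θ vMinus) = -θ vMinus := by
    rw [← RatClosure.torsionEquiv_smul_of_lift W ht c₀ (fun _ ↦ rfl) p vMinus, hvMinus, map_neg]
  have hPlus0 : θ vPlus ≠ 0 := fun h ↦ hvPlus0 (θ.injective (by rw [h, map_zero]))
  have hMinus0 : θ vMinus ≠ 0 := fun h ↦ hvMinus0 (θ.injective (by rw [h, map_zero]))
  -- ### Step A': the level-`p^M` inputs
  have hz' : ∀ P : geomTorsion (W.baseChange K) ((p ^ M : ℕ) : ℤ), z ^ p ^ (M - 1) • P = -P :=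
    smul_eq_neg_geomTorsion_pow (W.baseChange K) hodd hM hz
  obtain ⟨u, hu⟩ := exists_two_mul_zsmul_eq_of_odd (W.baseChange K) (n := p ^ M) hodd.pow
  obtain ⟨ePlus, hePlus', hPlus0'⟩ := ht.exists_eigenvector_pow W hinv hp hp2 hM (ν := 1)
    (Or.inl rfl) (e₁ := θ vPlus) (by rw [one_smul]; exact hePlus) hPlus0
  obtain ⟨eMinus, heMinus', hMinus0'⟩ := ht.exists_eigenvector_pow W hinv hp hp2 hM (ν := -1)
    (Or.inr rfl) (e₁ := θ vMinus) (by rw [neg_one_zsmul]; exact heMinus) hMinus0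
  rw [one_smul] at hePlus'
  rw [neg_one_zsmul] at heMinus'
  have hkill : ∀ P : geomTorsion (W.baseChange K) ((p ^ M : ℕ) : ℤ), ((p : ℤ) ^ M) • P = 0 :=
    fun P ↦ by
    apply Subtype.ext
    rw [AddSubgroupClass.coe_zsmul, ZeroMemClass.coe_zero]
    have := (mem_geomTorsion_iff (W.baseChange K) _ (P : geomPoints (W.baseChange K))).mp P.2
    exact_mod_cast this
  choose ν hν using hτ
  -- ### Step B: the choice of `ρ` (McCallum (2) and Prop. 3.1 at level `p^M`)
  obtain ⟨ρ, hρT, hρ⟩ := ht.exists_h1Eval_conj_mul_order W hinv hp hpn hS hCe hz' hu hePlus'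
    heMinus' (hkill ePlus) (hkill eMinus) hPlus0' hMinus0' (fun i ↦ (hν i).1) (fun i ↦ (hν i).2)
    ex hex hind Nv hNe hNM
  -- ### Step C: the finite exceptional set of places of `ℚ`
  have hbad : ((W.baseChange K).badPlaces (𝓞 K)).Finite :=
    (W.baseChange K).finite_badPlaces_holds (𝓞 K)
  choose T hTfin hT using fun i ↦
    exists_finite_forall_mem_unramifiedKer (W.baseChange K) hn0 (cs i)
  set B : Finset ℕ := {p} ∪ N.primeFactors ∪ (NumberField.discr K).natAbs.primeFactors ∪
    Finset.range (b + 1) with hB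
  set S₁ : Set (HeightOneSpectrum (𝓞 ℚ)) := {v | ∃ q ∈ B, q.Prime ∧ (q : 𝓞 ℚ) ∈ v.asIdeal}
    with hS₁
  set S₂ : Set (HeightOneSpectrum (𝓞 ℚ)) := {v | ¬ Algebra.IsUnramifiedIn (𝓞 K) v.asIdeal}
    with hS₂
  set S₃ : Set (HeightOneSpectrum (𝓞 ℚ)) :=
    (fun w : HeightOneSpectrum (𝓞 K) ↦ w.under (𝓞 ℚ)) ''
      ((W.baseChange K).badPlaces (𝓞 K) ∪ ⋃ i, T i) with hS₃
  have hS₁fin : S₁.Finite := by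
    have : S₁ ⊆ ⋃ q ∈ (B.filter Nat.Prime), {v | (q : 𝓞 ℚ) ∈ v.asIdeal} := by
      intro v ⟨q, hqB, hq, hqv⟩
      simp only [Set.mem_iUnion, Finset.mem_filter]
      exact ⟨q, ⟨hqB, hq⟩, hqv⟩
    refine Set.Finite.subset (Set.Finite.biUnion (Finset.finite_toSet _) fun q hq ↦ ?_) this
    rw [Finset.coe_filter, Set.mem_setOf_eq] at hq
    have hsub : {v : HeightOneSpectrum (𝓞 ℚ) | (q : 𝓞 ℚ) ∈ v.asIdeal}.Subsingleton :=
      fun v hv v' hv' ↦ HeightOneSpectrum.eq_of_natCast_mem_rat hq.2 hv hv'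
    exact hsub.finite
  have hS₂fin : S₂.Finite := finite_setOf_not_isUnramifiedIn ℚ K
  have hS₃fin : S₃.Finite :=
    (hbad.union (Set.finite_iUnion fun i ↦ hTfin i)).image _
  set S := S₁ ∪ S₂ ∪ S₃ with hSdef
  have hSfin : S.Finite := (hS₁fin.union hS₂fin).union hS₃fin
  -- ### Step D: Čebotarev in `Γ_ℚ`: a Frobenius in the open set `c₀ · res(ρ 𝒩)`
  set 𝒩 := evalKer (W.baseChange K) ((p ^ M : ℕ) : ℤ) cs with h𝒩
  have h𝒩open : IsOpen (𝒩 : Set (absoluteGaloisGroup K)) :=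
    isOpen_evalKer (W.baseChange K) _ cs (isOpen_torsionFixing (W.baseChange K) hn0)
  set O : Set (absoluteGaloisGroup ℚ) :=
    (fun γ ↦ c₀ * γ) '' (absGaloisRestrict ℚ K '' ((fun m ↦ ρ * m) '' (𝒩 : Set _))) with hO
  have hOopen : IsOpen O := by
    refine (Homeomorph.mulLeft c₀).isOpenMap _ (isOpenMap_absGaloisRestrict K _ ?_)
    exact (Homeomorph.mulLeft ρ).isOpenMap _ h𝒩open
  have hOne : O.Nonempty :=
    ⟨c₀ * absGaloisRestrict ℚ K (ρ * 1), _, ⟨_, ⟨1, 𝒩.one_mem, rfl⟩, rfl⟩, rfl⟩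
  obtain ⟨γ, hγO, v, hvS, 𝔓₀, h𝔓₀, hγ⟩ :=
    (absoluteGaloisGroup.frobenius_dense hC ℚ S hSfin).inter_open_nonempty O hOopen hOne
  obtain ⟨_, ⟨_, ⟨m, hm, rfl⟩, rfl⟩, rfl⟩ := hγO
  set g := ρ * m with hg
  have hgT : g ∈ torsionFixing (W.baseChange K) ((p ^ M : ℕ) : ℤ) := mul_mem hρT hm.1
  -- ### Step E: the rational prime `ℓ` under `v`
  obtain ⟨ℓ, hℓ, hℓv⟩ := exists_prime_natCast_mem v
  have hℓB : ℓ ∉ B := fun h ↦ hvS (Or.inl (Or.inl ⟨ℓ, h, hℓ, hℓv⟩))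
  simp only [hB, Finset.mem_union, Finset.mem_singleton, Nat.mem_primeFactors,
    Finset.mem_range, not_or] at hℓB
  obtain ⟨⟨⟨hℓp, hℓN⟩, hℓD⟩, hℓb⟩ := hℓB
  have hℓN' : ¬ ℓ ∣ N := fun h ↦ hℓN ⟨hℓ, h, NeZero.ne N⟩
  have hℓD' : ¬ ((ℓ : ℤ) ∣ NumberField.discr K) := fun h ↦
    hℓD ⟨hℓ, Int.natAbs_dvd_natAbs.mpr h |>.trans (by simp), by
      simp [NumberField.discr_ne_zero]⟩
  have hbℓ : b < ℓ := by omega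
  have hunr : Algebra.IsUnramifiedIn (𝓞 K) v.asIdeal := by
    by_contra h; exact hvS (Or.inl (Or.inr h))
  have hvS₃ : v ∉ S₃ := fun h ↦ hvS (Or.inr h)
  -- ### Step F: `ℓ` is inert, with a Frobenius `τ' = g^τ g` over `K`
  have hHi := index_range_absGaloisRestrict_eq_finrank ℚ K
  haveI hHn : ((absGaloisRestrict ℚ K).range).Normal :=
    Subgroup.normal_of_index_eq_two (hHi.trans hK.1)
  have hI := inertia_le_range_absGaloisRestrict_of_isUnramifiedIn (K := K) hunr h𝔓₀
  have hΦH : c₀ * absGaloisRestrict ℚ K g ∉ (absGaloisRestrict ℚ K).range := by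
    intro h
    apply hc₀.not_mem_range_absGaloisRestrict (L := K) IsTotallyComplex.isComplex
    change c₀ ∈ ((absGaloisRestrict ℚ K).range : Set (absoluteGaloisGroup ℚ))
    have h' : c₀ = c₀ * absGaloisRestrict ℚ K g * (absGaloisRestrict ℚ K g)⁻¹ := by group
    rw [SetLike.mem_coe, h']
    exact Subgroup.mul_mem _ h (Subgroup.inv_mem _ ⟨g, rfl⟩)
  obtain ⟨w, 𝔔, τ', hwv, hwuniq, -, h𝔔w, -, hτ', hresτ'⟩ :=
    exists_place_inert_of_not_mem_range (F := ℚ) (M := K) (hK.1 ▸ Nat.prime_two) hHn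
      (hHi.trans rfl) hunr h𝔓₀ hI hγ hΦH
  rw [hK.1, sq_eq_absGaloisRestrict_conjGal_mul hc₀ ht g] at hresτ'
  have hτ'eq : τ' = ht.conjGalCMH g * g := absGaloisRestrict_injective ℚ K hresτ'
  -- `ℓ ∈ w`, and `w` is the only place of `K` containing `ℓ`
  have hℓw : (ℓ : 𝓞 K) ∈ w.asIdeal := by
    have h1 : (ℓ : 𝓞 ℚ) ∈ (w.under (𝓞 ℚ)).asIdeal := by rw [hwv]; exact hℓv
    rw [HeightOneSpectrum.under_asIdeal, Ideal.under_def, Ideal.mem_comap, map_natCast] at h1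
    exact h1
  have hwuniq' : ∀ w' : HeightOneSpectrum (𝓞 K), (ℓ : 𝓞 K) ∈ w'.asIdeal → w' = w := by
    intro w' hw'
    apply hwuniq
    apply HeightOneSpectrum.eq_of_natCast_mem_rat hℓ _ hℓv
    rw [HeightOneSpectrum.under_asIdeal, Ideal.under_def, Ideal.mem_comap, map_natCast]
    exact hw'
  -- `(ℓ) = w` is prime
  have hspan : Ideal.span {(ℓ : 𝓞 K)} = w.asIdeal := by
    apply span_natCast_eq_of_unique hℓ w hwuniq'
    haveI : w.asIdeal.LiesOver v.asIdeal := ⟨by rw [← hwv]; rfl⟩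
    have hmap : v.asIdeal.map (algebraMap (𝓞 ℚ) (𝓞 K)) = Ideal.span {(ℓ : 𝓞 K)} := by
      rw [← span_natCast_rat_eq hℓ hℓv, Ideal.map_span, Set.image_singleton, map_natCast]
    have hne : v.asIdeal.map (algebraMap (𝓞 ℚ) (𝓞 K)) ≠ ⊥ := by
      rw [hmap, Ne, Ideal.span_singleton_eq_bot]; exact_mod_cast hℓ.ne_zero
    rw [← hmap, ← Ideal.IsDedekindDomain.ramificationIdx_eq_normalizedFactors_count v.asIdeal
      w.asIdeal hne]
    exact Ideal.ramificationIdx_eq_one_iff.mpr (hunr w.asIdeal w.isPrime inferInstance)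
  -- ### Step G: the local criterion at `w`, for the classes `p^a c_i`
  have hloc : ∀ i (a : ℕ), (((p : ℤ) ^ a) • cs i ∈
      (W.baseChange K).torsionLocalKer (w.adicCompletion K) ((p ^ M : ℕ) : ℤ) ↔
        ((p : ℤ) ^ a) • h1Eval (W.baseChange K) ((p ^ M : ℕ) : ℤ) (cs i)
          (ht.conjGalCMH (ρ * m) * (ρ * m)) = 0) := by
    intro i a
    haveI : CharZero (w.adicCompletion K) :=
      charZero_of_injective_algebraMap (algebraMap K (w.adicCompletion K)).injective
    obtain ⟨𝔐, h𝔐⟩ := w.localPrimesAbove_nonempty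
    set 𝔓w := w.primeBelow (closureEmb (K := K) (w.adicCompletion K)) 𝔐 with h𝔓w_def
    have h𝔓w : 𝔓w ∈ w.primesAbove := w.primeBelow_mem_primesAbove h𝔐
    obtain ⟨δ, hδ, hF⟩ :=
      HeightOneSpectrum.exists_isArithFrobAt_conj_of_mem_primesAbove_holds h𝔔w h𝔓w hτ'
    have hτ'T : τ' ∈ torsionFixing (W.baseChange K) ((p ^ M : ℕ) : ℤ) := by
      rw [hτ'eq]; exact mul_mem (ht.conjGalCMH_mem_torsionFixing W hinv _ hgT) hgT
    have hFT : δ * τ' * δ⁻¹ ∈ torsionFixing (W.baseChange K) ((p ^ M : ℕ) : ℤ) :=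
      (torsionFixing_normal (W.baseChange K) _).conj_mem _ hτ'T δ
    have hwbad : w ∉ (W.baseChange K).badPlaces (𝓞 K) := fun h ↦
      hvS₃ ⟨w, Or.inl h, hwv⟩
    have hwT : w ∉ T i := fun h ↦ hvS₃ ⟨w, Or.inr (Set.mem_iUnion.mpr ⟨i, h⟩), hwv⟩
    have hpw : ((p : ℤ) : 𝓞 K) ∉ w.asIdeal := by
      rw [Int.cast_natCast]
      exact not_natCast_mem_of_prime_ne hℓ hp hℓp w hℓw
    have hpMw : ((((p ^ M : ℕ) : ℤ)) : 𝓞 K) ∉ w.asIdeal := fun h ↦ by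
      apply hpw
      rw [Int.cast_natCast, Nat.cast_pow] at h
      rw [Int.cast_natCast]
      exact w.isPrime.mem_of_pow_mem M h
    have hcrit := mem_torsionLocalKer_iff_h1Eval_eq_zero (W.baseChange K) ((p ^ M : ℕ) : ℤ) h𝔐 hF
      hFT (inertia_le_torsionFixing (W.baseChange K) hwbad hpMw _ h𝔐)
      (isOpen_torsionFixing (W.baseChange K) hn0)
      (torsionPointsMap_bijective (W.baseChange K) (w.adicCompletion K)
        (pow_ne_zero M hp.ne_zero)).2
      (AddSubgroup.zsmul_mem _ (hT i w hwT 𝔓w h𝔓w) ((p : ℤ) ^ a))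
    rw [hcrit, h1Eval_conj (W.baseChange K) _ _ δ hτ'T, smul_eq_zero_iff_eq,
      h1Eval_zsmul (W.baseChange K) _ _ _ hτ'T, hτ'eq]
  -- ### Step H: assemble
  refine ⟨ℓ, hbℓ, hℓ, hℓN', hℓD', hℓp, hspan ▸ w.isPrime, ?_, fun i v' hv' ↦ ?_⟩
  · -- Cor. 3.2 (1): `γ = c₀ · res g` acts on `E(ℚ̄)[p^M]` and on `K` as `c₀`
    refine ⟨v, 𝔓₀, c₀ * absGaloisRestrict ℚ K g, c₀, hℓv, h𝔓₀, hγ, hc₀, fun P ↦ ?_, fun e x ↦ ?_⟩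
    · rw [mul_smul, absGaloisRestrict_smul_eq_of_mem_torsionFixing W hgT]
    · rw [mul_smul, absGaloisRestrict_smul_apply_eq g e x]
  · rw [hwuniq' v' hv']
    refine ⟨(hloc i (Nv i)).mpr (hρ m hm i).1, fun hN h ↦ (hρ m hm i).2 hN ((hloc i _).mp h)⟩


/-- `Frob(ℓ) = Frob(∞)` on `E[n]` implies the same on `E[m]` for `m ∣ n` (`E[m] ⊆ E[n]`).
[folklore] -/
theorem FrobEqFrobInfty.of_dvd {m n : ℕ} (hmn : m ∣ n) {ℓ : ℕ} (h : FrobEqFrobInfty W K n ℓ) :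
    FrobEqFrobInfty W K m ℓ := by
  obtain ⟨v, 𝔓, h₁, c₀, hv, h𝔓, hF, hc₀, hP, hK⟩ := h
  refine ⟨v, 𝔓, h₁, c₀, hv, h𝔓, hF, hc₀, fun P ↦ ?_, hK⟩
  have hle : geomTorsion W (m : ℤ) ≤ geomTorsion W (n : ℤ) :=
    W.geomTorsion_le_of_dvd (Int.natCast_dvd_natCast.mpr hmn)
  have := hP (AddSubgroup.inclusion hle P)
  apply Subtype.ext
  exact congrArg (fun x : geomTorsion W (n : ℤ) ↦ (x : geomPoints W)) this

/-- The `p`-exponent of a non-zero class of `H¹(K, E[p^M])`: `ord c = p^e` with `1 ≤ e ≤ M`, and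
`a c = 0 ⟹ p^e ∣ a` (`H¹(K, E[p^M])` is killed by `p^M`, `zsmul_galH1Torsion_eq_zero`).
[folklore] -/
theorem exists_addOrderOf_eq_pow {F : Type u} [Field F] (V : WeierstrassCurve F) {p : ℕ}
    (hp : p.Prime) (M : ℕ) {x : galH1Torsion V ((p ^ M : ℕ) : ℤ)} (hx : x ≠ 0) :
    ∃ e : ℕ, 1 ≤ e ∧ e ≤ M ∧ ((p : ℤ) ^ e) • x = 0 ∧ ((p : ℤ) ^ (e - 1)) • x ≠ 0 ∧
      addOrderOf x = p ^ e := by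
  classical
  haveI : Fact p.Prime := ⟨hp⟩
  have hkill : ((p : ℤ) ^ M) • x = 0 := by
    have := zsmul_galH1Torsion_eq_zero V _ x
    exact_mod_cast this
  have hexM : ∃ a : ℕ, ((p : ℤ) ^ a) • x = 0 := ⟨M, hkill⟩
  set e := Nat.find hexM with he
  have hspec : ((p : ℤ) ^ e) • x = 0 := Nat.find_spec hexM
  have heM : e ≤ M := Nat.find_min' hexM hkill
  have he0 : e ≠ 0 := fun h ↦ hx (by rw [h, pow_zero, one_smul] at hspec; exact hspec)
  have he1 : 1 ≤ e := Nat.one_le_iff_ne_zero.mpr he0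
  have hmin : ((p : ℤ) ^ (e - 1)) • x ≠ 0 := Nat.find_min hexM (by omega)
  refine ⟨e, he1, heM, hspec, hmin, ?_⟩
  have := addOrderOf_eq_prime_pow (p := p) (n := e - 1) (x := x)
    (by
      intro h
      apply hmin
      rw [← natCast_zsmul] at h
      exact_mod_cast h)
    (by
      rw [Nat.sub_add_cancel he1, ← natCast_zsmul]
      exact_mod_cast hspec)
  rwa [Nat.sub_add_cancel he1] at this

/-- **McCallum 1991, Cor. 3.2 at level `p^M`, in the shape of the `cebotarev` field of
`KolyvaginDescent.HypothesesM`** (`HeegnerPointsKolyvaginPrimaryDescentProofs`), from the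
Čebotarev density theorem and the Weil pairing on `E[p]`. Hypotheses as printed (PDF p. 280):
non-zero classes `c_i ∈ H¹(K, E_{p^M})`, *independent* — *"any relation `a₁c₁ + ⋯ + a_rc_r = 0`
implies that `ord c_i` divides `a_i`"*, i.e. `a_i c_i = 0` — and `0 ≤ N_i ≤ M_i` where
`p^{M_i} = ord c_i` (as `p^{N_i - 1} c_i ≠ 0`); `τ c_i = ±c_i` (the eigenclass hypothesis under
which the printed proof is correct, as for the tree's `M = 1` leaf `McCallum1991_cor_3_2_eigen`).
Conclusion: above every bound there is a Kolyvagin prime `ℓ` (`IsKolyvaginPrime N W K p ℓ`) with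
`Frob(ℓ) = Frob(∞)` in `Gal(K(E_{p^M})/ℚ)` (condition 1) and `ord c_{i,λ} = p^{N_i}` at the place
`λ ∋ ℓ` (condition 2). With `HeegnerPointsKolyvaginPrimaryPairingProofs` this removes, at every
level `M`, the Čebotarev leaf from what `Kolyvagin1990_sha_primary_finite_of_hypothesesM` asks for
at the primes `p` with `ρ̄_{E,p}` onto. [cite: McCallumLMS1991, §3 Cor. 3.2 (with Prop. 3.1)] -/
theorem McCallum1991_cor_3_2_pow_of_chebotarev (hC : Automorphic.chebotarev_artinRep) {N : ℕ}
    [NeZero N] [W.IsElliptic] (hK : IsImaginaryQuadratic K) {p : ℕ} (hp : p.Prime) (hp2 : p ≠ 2)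
    (hρ : W.HasSurjectiveModNGaloisRep p) (hW : W.exists_weilPairing p) {M : ℕ} (hM : 1 ≤ M)
    {c : K ≃ₐ[ℚ] K} (hc : c ≠ 1) {r : ℕ}
    (cs : Fin r → galH1Torsion (W.baseChange K) ((p ^ M : ℕ) : ℤ)) (h0 : ∀ i, cs i ≠ 0)
    (Nv : Fin r → ℕ) (hN : ∀ i, Nv i ≠ 0 → ((p : ℤ) ^ (Nv i - 1)) • cs i ≠ 0)
    (hτ : ∀ i, ∃ e : ℤ, (e = 1 ∨ e = -1) ∧ conjAct W c ((p ^ M : ℕ) : ℤ) (cs i) = e • cs i)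
    (hind : ∀ a : Fin r → ℤ, ∑ i, a i • cs i = 0 → ∀ i, a i • cs i = 0) (b : ℕ) :
    ∃ ℓ : ℕ, b < ℓ ∧ IsKolyvaginPrime N W K p ℓ ∧ FrobEqFrobInfty W K (p ^ M) ℓ ∧
      ∀ i, ∀ v : HeightOneSpectrum (𝓞 K), (ℓ : 𝓞 K) ∈ v.asIdeal →
        (((p : ℤ) ^ Nv i) • cs i ∈
            (W.baseChange K).torsionLocalKer (v.adicCompletion K) ((p ^ M : ℕ) : ℤ) ∧
          (Nv i ≠ 0 → ((p : ℤ) ^ (Nv i - 1)) • cs i ∉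
            (W.baseChange K).torsionLocalKer (v.adicCompletion K) ((p ^ M : ℕ) : ℤ))) := by
  -- exponents `p^{e_i} = ord c_i`
  choose ex hex1 hexM hex hexmin hord using fun i ↦
    exists_addOrderOf_eq_pow (W.baseChange K) hp M (hx := h0 i)
  have hind' : ∀ a : Fin r → ℤ, ∑ i, a i • cs i = 0 → ∀ i, ((p : ℤ) ^ ex i) ∣ a i := by
    intro a ha i
    have h := (addOrderOf_dvd_iff_zsmul_eq_zero).mpr (hind a ha i)
    rwa [hord i, Nat.cast_pow] at h
  have hNe : ∀ i, Nv i ≤ ex i := fun i ↦ by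
    by_contra hlt
    have hlt := Nat.lt_of_not_le hlt
    have hk : ((p : ℤ) ^ (Nv i - 1)) • cs i = 0 := by
      have : Nv i - 1 = (Nv i - 1 - ex i) + ex i := by omega
      rw [this, pow_add, mul_smul, hex i]
      exact zsmul_zero _
    exact hN i (by omega) hk
  have hNM : ∀ i, Nv i ≤ M := fun i ↦ (hNe i).trans (hexM i)
  obtain ⟨ℓ, hbℓ, hℓ, hℓN, hℓD, hℓp, hprime, hfrob, hloc⟩ :=
    exists_kolyvaginPrime_gt_pow (N := N) hC hK hp hp2 hρ hW hM hc cs hτ ex hex hind' Nv hNe hNM b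
  exact ⟨ℓ, hbℓ, ⟨hℓ, hℓN, hℓD, hℓp, hprime, hfrob.of_dvd (dvd_pow_self p (by omega))⟩, hfrob, hloc⟩

end Main

end Literature.NumberTheory.EllipticCurves

end
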